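import Literature.NumberTheory.ModularForms.PoincareSeriesWeightTwoHecke
import Literature.NumberTheory.EllipticCurves.RankinSelbergStripIntegral
import Literature.Analysis.Complex.DiscSubMeanValue
import Mathlib.NumberTheory.ModularForms.Basic
import Mathlib.NumberTheory.Modular
import Mathlib.Analysis.Complex.UpperHalfPlane.Measure
import Mathlib.MeasureTheory.Integral.Lebesgue.DominatedConvergence
import HarnessLib

/-!
# A square-integrable holomorphic function of weight `2` for `Γ₀(N)` is a cusp form

Topic `Literature/NumberTheory/ModularForms` (namespace
`Literature.NumberTheory.ModularForms.PoincareWeightTwo`, continuing the definitions file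
`PoincareSeriesWeightTwoHecke.lean`). Everything here is PROVED; no definition, no named fact.

**Main result** (`cuspFormOfL2`). Let `g : ℍ → ℂ` be holomorphic, of weight `2` for `Γ₀(N)`
(`g(γz) = (cz+d)² g(z)` for `γ ∈ Γ₀(N)`), and square-integrable in the normalisation of the
tree's `peterssonPairing` (`PeterssonSqIntegrable N 2 g`: the function
`Σ_{q ∈ SL(2,ℤ)/Γ₀(N)} |g(q⁻¹τ)|² (Im q⁻¹τ)²` is integrable on the standard fundamental domain
`𝒟 = ModularGroup.fd` for `dμ = dx dy / y²`). Then `g` is (the underlying function of) a Mathlib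
`CuspForm (Gamma0 N) 2`. This is the statement `CuspFormOfL2` (stub T5) of the Hecke–Selberg `L²`
line for Petersson's formula at weight `2` (Iwaniec–Kowalski §14.1–§14.2); its consumer is the
tree's fact skeleton for `kowalskiMichel2000_peterssonFormula`.

**Proof** (Bergman-space point evaluation; no Fourier expansion is used). Fix `γ ∈ SL(2, ℤ)`, put
`h = g ∣[2] γ` and `E(τ) = |g(τ)|² (Im τ)²`; `E` is `Γ₀(N)`-invariant and `|h(τ)|² (Im τ)² = E(γτ)`
(`norm_sq_slash_mul_im_sq`). For `Im z ≥ n + 1` the sub-mean-value inequality on the unit disc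
about `z` (the tree's `Literature.Analysis.Complex.pi_mul_sq_mul_enorm_sq_le_lintegral_ball`) and
`dx dy = y² dμ` give `π |h(z)|² ≤ ∫_{B(z,1)} |h|² dx dy = ∫_{B(z,1)} E(γτ) dμ(τ)`. The disc lies in
four translates `T^j {τ ∈ 𝒟 : Im τ > n}` (`exists_mem_T_zpow_smul`); by the `GL(2,ℝ)`-invariance
of `μ` (Mathlib) and the `Γ₀(N)`-invariance of `E`, each translate contributes at most
`∫_{𝒟 ∩ {Im > n}} Σ_q E(q⁻¹τ) dμ` (`exists_coset_term_eq`), which tends to `0` as `n → ∞` by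
dominated convergence (`tendsto_lintegral_cuspRegion`). Hence `h → 0` at `i∞` for every `γ`,
i.e. `g` vanishes at every cusp of `Γ₀(N)` (Mathlib: the cusps of an arithmetic group are
`SL(2,ℤ) · ∞`).

## References

* [IwaniecKowalski2004] H. Iwaniec, E. Kowalski, *Analytic Number Theory*, §14.1 ((14.11)).
* [DiamondShurman2005] F. Diamond, J. Shurman, *A First Course in Modular Forms*, §1.2, §5.4.
* [Gelbart1975] S. Gelbart, *Automorphic Forms on Adele Groups*, Prop. 2.1 (`S_k(Γ)` inside
  `L²(Γ\G)`; a representation-theoretic treatment of the same circle of facts).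
-/

noncomputable section

open scoped MatrixGroups Real Manifold Topology ENNReal ModularForm Pointwise
open CongruenceSubgroup Complex MeasureTheory Filter Set
open UpperHalfPlane hiding I
open Literature.NumberTheory.EllipticCurves.ModularForms (measurable_ofComplex)
open Literature.MeasureTheory.Group (setLIntegral_coe_preimage)
open Literature.Analysis.Complex (pi_mul_sq_mul_enorm_sq_le_lintegral_ball)

namespace Literature.NumberTheory.ModularForms.PoincareWeightTwo

variable {N : ℕ}

/-! ### Weight-`2` invariance and the density `|g|² y²` -/

/-- The functional equation `g(γz) = (cz+d)² g(z)` for `γ ∈ Γ₀(N)` is Mathlib's slash invariance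
`g ∣[2] γ = g` (the weight-`k` operator `[γ]_k`).
[cite: DiamondShurman2005, §1.2 (the weight-k operator [γ]_k)] -/
theorem slash_eq_self_of_invariant {g : ℍ → ℂ}
    (hinv : ∀ γ : SL(2, ℤ), γ ∈ Gamma0 N → ∀ z : ℍ,
      g (γ • z) = (rowDenom ((γ : Matrix (Fin 2) (Fin 2) ℤ) 1) z) ^ 2 * g z)
    {γ : SL(2, ℤ)} (hγ : γ ∈ Gamma0 N) : g ∣[(2 : ℤ)] γ = g := by
  funext z
  rw [ModularForm.slash_action_eq'_iff, hinv γ hγ z, zpow_two, pow_two]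
  rfl

/-- The weight-`2` density transforms by `|(g ∣[2] γ)(τ)|² (Im τ)² = |g(γτ)|² (Im γτ)²` for
`γ ∈ SL(2, ℤ)` (`Im γτ = Im τ / |cτ+d|²`; Diamond–Shurman §5.4: the Petersson integrand
`f ḡ (Im)^k` transforms under `[γ]_k` by `τ ↦ γτ`).
[cite: DiamondShurman2005, §5.4 (invariance of f·ḡ·(Im τ)^k under the weight-k operator)] -/
theorem norm_sq_slash_mul_im_sq (g : ℍ → ℂ) (γ : SL(2, ℤ)) (τ : ℍ) :
    ‖(g ∣[(2 : ℤ)] γ) τ‖ ^ 2 * τ.im ^ 2 = ‖g (γ • τ)‖ ^ 2 * (γ • τ).im ^ 2 := by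
  rw [ModularForm.SL_slash_apply, ModularGroup.im_smul_eq_div_normSq, norm_mul, norm_zpow,
    Complex.normSq_eq_norm_sq]
  have h : ‖denom (γ : GL (Fin 2) ℝ) τ‖ ≠ 0 := norm_ne_zero_iff.mpr (denom_ne_zero _ _)
  rw [zpow_neg, zpow_ofNat]
  field_simp

/-- For `g` of weight `2` for `Γ₀(N)` the density `|g(τ)|² (Im τ)²` is `Γ₀(N)`-invariant
(Diamond–Shurman §5.4; Iwaniec–Kowalski (14.11)).
[cite: DiamondShurman2005, §5.4 (Γ-invariance of f·ḡ·(Im τ)^k)] -/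
theorem norm_sq_smul_mul_im_sq_of_invariant {g : ℍ → ℂ}
    (hinv : ∀ γ : SL(2, ℤ), γ ∈ Gamma0 N → ∀ z : ℍ,
      g (γ • z) = (rowDenom ((γ : Matrix (Fin 2) (Fin 2) ℤ) 1) z) ^ 2 * g z)
    {β : SL(2, ℤ)} (hβ : β ∈ Gamma0 N) (τ : ℍ) :
    ‖g (β • τ)‖ ^ 2 * (β • τ).im ^ 2 = ‖g τ‖ ^ 2 * τ.im ^ 2 := by
  have h := norm_sq_slash_mul_im_sq g β τ
  rw [slash_eq_self_of_invariant hinv hβ] at h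
  exact h.symm

/-- The same invariance for elements of the image of `Γ₀(N)` in `GL(2, ℝ)`. [folklore] -/
private theorem norm_sq_smul_mul_im_sq_of_mem_map {g : ℍ → ℂ}
    (hinv : ∀ γ : SL(2, ℤ), γ ∈ Gamma0 N → ∀ z : ℍ,
      g (γ • z) = (rowDenom ((γ : Matrix (Fin 2) (Fin 2) ℤ) 1) z) ^ 2 * g z)
    {x : GL (Fin 2) ℝ} (hx : x ∈ (Gamma0 N : Subgroup (GL (Fin 2) ℝ))) (τ : ℍ) :
    ‖g (x • τ)‖ ^ 2 * (x • τ).im ^ 2 = ‖g τ‖ ^ 2 * τ.im ^ 2 := by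
  obtain ⟨β, hβ, rfl⟩ := Subgroup.mem_map.mp hx
  exact norm_sq_smul_mul_im_sq_of_invariant hinv hβ τ

/-- For every `δ ∈ SL(2, ℤ)` the density `|g(δτ)|² (Im δτ)²` is one of the summands
`|g(q⁻¹τ)|² (Im q⁻¹τ)²`, `q ∈ SL(2,ℤ)/Γ₀(N)` (with Mathlib's chosen representatives `q.out`), of
the integrand of `PeterssonSqIntegrable N 2 g`: take `q = δ⁻¹ Γ₀(N)`. [folklore] -/
private theorem exists_coset_term_eq {g : ℍ → ℂ}
    (hinv : ∀ γ : SL(2, ℤ), γ ∈ Gamma0 N → ∀ z : ℍ,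
      g (γ • z) = (rowDenom ((γ : Matrix (Fin 2) (Fin 2) ℤ) 1) z) ^ 2 * g z)
    (δ : SL(2, ℤ)) :
    ∃ q : 𝒮ℒ ⧸ (Gamma0 N : Subgroup (GL (Fin 2) ℝ)).subgroupOf 𝒮ℒ, ∀ τ : ℍ,
      ‖g (((q.out : 𝒮ℒ) : GL (Fin 2) ℝ)⁻¹ • τ)‖ ^ 2 *
          ((((q.out : 𝒮ℒ) : GL (Fin 2) ℝ)⁻¹ • τ).im) ^ 2 =
        ‖g (δ • τ)‖ ^ 2 * (δ • τ).im ^ 2 := by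
  set a : 𝒮ℒ := ⟨Matrix.SpecialLinearGroup.mapGL ℝ δ⁻¹, δ⁻¹, rfl⟩ with ha
  refine ⟨(a : 𝒮ℒ ⧸ (Gamma0 N : Subgroup (GL (Fin 2) ℝ)).subgroupOf 𝒮ℒ), fun τ ↦ ?_⟩
  obtain ⟨h, hh⟩ :=
    QuotientGroup.mk_out_eq_mul ((Gamma0 N : Subgroup (GL (Fin 2) ℝ)).subgroupOf 𝒮ℒ) a
  rw [hh]
  have hmem : ((h : 𝒮ℒ) : GL (Fin 2) ℝ) ∈ (Gamma0 N : Subgroup (GL (Fin 2) ℝ)) :=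
    Subgroup.mem_subgroupOf.mp h.2
  have e1 : (((a * h : 𝒮ℒ) : GL (Fin 2) ℝ)⁻¹ • τ) =
      ((h : 𝒮ℒ) : GL (Fin 2) ℝ)⁻¹ • ((Matrix.SpecialLinearGroup.mapGL ℝ δ) • τ) := by
    rw [Subgroup.coe_mul, mul_inv_rev, mul_smul]
    congr 1
    change ((Matrix.SpecialLinearGroup.mapGL ℝ δ⁻¹)⁻¹) • τ = _
    rw [map_inv, inv_inv]
  rw [e1, norm_sq_smul_mul_im_sq_of_mem_map hinv (inv_mem hmem)]
  rfl

/-! ### Analytic lemmas -/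

/-- On the ball `B(z₀, r) ⊂ ℂ` one has `|Im w - Im z₀| < r`. [folklore] -/
private theorem abs_im_sub_lt_of_mem_ball {z₀ w : ℂ} {r : ℝ} (hw : w ∈ Metric.ball z₀ r) :
    |w.im - z₀.im| < r :=
  lt_of_le_of_lt (by simpa using abs_im_le_norm (w - z₀)) (mem_ball_iff_norm.mp hw)

/-- On the ball `B(z₀, r) ⊂ ℂ` one has `|Re w - Re z₀| < r`. [folklore] -/
private theorem abs_re_sub_lt_of_mem_ball {z₀ w : ℂ} {r : ℝ} (hw : w ∈ Metric.ball z₀ r) :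
    |w.re - z₀.re| < r :=
  lt_of_le_of_lt (by simpa using abs_re_le_norm (w - z₀)) (mem_ball_iff_norm.mp hw)

/-- The unit ball about a point of height `≥ 1` lies in the upper half-plane. [folklore] -/
private theorem ball_subset_upperHalfPlane {z₀ : ℍ} (hz₀ : 1 ≤ z₀.im) :
    Metric.ball (z₀ : ℂ) 1 ⊆ {w : ℂ | 0 < w.im} := fun w hw ↦ by
  have := (abs_lt.mp (abs_im_sub_lt_of_mem_ball hw)).1
  rw [UpperHalfPlane.coe_im] at this
  show 0 < w.im
  linarith

/-- **`dx dy = y² dμ` on a ball**: for continuous `h : ℍ → ℂ` and `Im z₀ ≥ 1`,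
`∫_{B(z₀,1)} |h|² dx dy = ∫_{B(z₀,1)} |h(τ)|² (Im τ)² dμ(τ)` (`μ` = Mathlib's invariant `volume` on
`ℍ`; the tree's `setLIntegral_coe_preimage`). [folklore] -/
private theorem lintegral_ball_eq_lintegral_preimage (h : ℍ → ℂ) (hc : Continuous h) {z₀ : ℍ}
    (hz₀ : 1 ≤ z₀.im) :
    ∫⁻ w in Metric.ball (z₀ : ℂ) 1, ‖h (ofComplex w)‖ₑ ^ 2 =
      ∫⁻ τ in ((↑) : ℍ → ℂ) ⁻¹' Metric.ball (z₀ : ℂ) 1,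
        ENNReal.ofReal (‖h τ‖ ^ 2 * τ.im ^ 2) := by
  have hball := ball_subset_upperHalfPlane hz₀
  have hmeas : Measurable fun w : ℂ ↦ ‖h (ofComplex w)‖ₑ ^ 2 * ENNReal.ofReal (w.im ^ 2) :=
    ((hc.measurable.comp measurable_ofComplex).enorm.pow_const 2).mul
      ((Complex.measurable_im.pow_const 2).ennreal_ofReal)
  symm
  calc ∫⁻ τ in ((↑) : ℍ → ℂ) ⁻¹' Metric.ball (z₀ : ℂ) 1, ENNReal.ofReal (‖h τ‖ ^ 2 * τ.im ^ 2)
      = ∫⁻ τ in ((↑) : ℍ → ℂ) ⁻¹' Metric.ball (z₀ : ℂ) 1,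
          (fun w : ℂ ↦ ‖h (ofComplex w)‖ₑ ^ 2 * ENNReal.ofReal (w.im ^ 2)) (τ : ℂ) := by
        refine lintegral_congr fun τ ↦ ?_
        simp only [ofComplex_apply, UpperHalfPlane.coe_im]
        rw [ENNReal.ofReal_mul (by positivity), ← ofReal_norm,
          ENNReal.ofReal_pow (norm_nonneg _)]
    _ = ∫⁻ w in Metric.ball (z₀ : ℂ) 1, ‖h (ofComplex w)‖ₑ ^ 2 * ENNReal.ofReal (w.im ^ 2) *
          ENNReal.ofReal (1 / w.im ^ 2) :=
        setLIntegral_coe_preimage measurableSet_ball hball _ hmeas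
    _ = ∫⁻ w in Metric.ball (z₀ : ℂ) 1, ‖h (ofComplex w)‖ₑ ^ 2 := by
        refine setLIntegral_congr_fun measurableSet_ball fun w hw ↦ ?_
        have hw' : 0 < w.im := hball hw
        rw [mul_assoc, ← ENNReal.ofReal_mul (by positivity),
          mul_one_div_cancel (by positivity), ENNReal.ofReal_one, mul_one]

/-- **Sub-mean-value inequality** for a holomorphic `h : ℍ → ℂ` on the unit disc about `z₀`,
`Im z₀ ≥ 1`: `π |h(z₀)|² ≤ ∫_{B(z₀,1)} |h|² dx dy` (the tree's
`pi_mul_sq_mul_enorm_sq_le_lintegral_ball`). [folklore] -/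
private theorem ofReal_pi_mul_norm_sq_le_lintegral_ball (h : ℍ → ℂ)
    (hh : MDifferentiable 𝓘(ℂ) 𝓘(ℂ) h) {z₀ : ℍ} (hz₀ : 1 ≤ z₀.im) :
    ENNReal.ofReal (π * ‖h z₀‖ ^ 2) ≤
      ∫⁻ w in Metric.ball (z₀ : ℂ) 1, ‖h (ofComplex w)‖ₑ ^ 2 := by
  have hball := ball_subset_upperHalfPlane hz₀
  have hd : DifferentiableOn ℂ (fun w ↦ h (ofComplex w)) (Metric.ball (z₀ : ℂ) 1) :=
    (UpperHalfPlane.mdifferentiable_iff.mp hh).mono hball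
  have hm : Measurable (fun w ↦ h (ofComplex w)) :=
    hh.continuous.measurable.comp measurable_ofComplex
  have key := pi_mul_sq_mul_enorm_sq_le_lintegral_ball one_pos hd hm
  rw [one_pow, mul_one, ofComplex_apply] at key
  rw [ENNReal.ofReal_mul Real.pi_pos.le, ENNReal.ofReal_pow (norm_nonneg _), ofReal_norm]
  exact key

/-- Invariance of the measure `dμ = dx dy / y²` of `ℍ` under `GL(2, ℝ)` (Mathlib's
`SMulInvariantMeasure`), as a change of variables on a translate:
`∫_{c • s} f dμ = ∫_s f(c • τ) dμ(τ)`.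
[cite: DiamondShurman2005, §5.4 (invariance of dμ(τ) = dx dy/y²)] -/
theorem lintegral_smul_set_eq (c : GL (Fin 2) ℝ) (s : Set ℍ) (f : ℍ → ℝ≥0∞) :
    ∫⁻ τ in c • s, f τ = ∫⁻ τ in s, f (c • τ) := by
  rw [← Set.image_smul, ← (measurePreserving_smul c (volume : Measure ℍ)).setLIntegral_comp_emb
    (measurableEmbedding_const_smul c) f s]

/-- **The unit disc about a high point is covered by four translates of the cusp region of `𝒟`**:
if `1 ≤ Y`, `Im z₀ ≥ Y + 1` and `τ ∈ B(z₀, 1)`, then `τ ∈ T^j {σ ∈ 𝒟 : Im σ > Y}` for some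
`j ∈ {⌊Re z₀⌋ - 1, …, ⌊Re z₀⌋ + 2}` (take `j` the nearest integer to `Re τ`). [folklore] -/
private theorem exists_mem_T_zpow_smul {z₀ τ : ℍ} {Y : ℝ} (hY : 1 ≤ Y) (hz₀ : Y + 1 ≤ z₀.im)
    (hτ : (τ : ℂ) ∈ Metric.ball (z₀ : ℂ) 1) :
    ∃ i : Fin 4, τ ∈ ((ModularGroup.T ^ (⌊z₀.re⌋ - 1 + (i : ℤ)) : SL(2, ℤ)) : GL (Fin 2) ℝ) •
      ({σ : ℍ | Y < σ.im} ∩ ModularGroup.fd) := by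
  have hre := abs_re_sub_lt_of_mem_ball hτ
  have him := abs_im_sub_lt_of_mem_ball hτ
  rw [UpperHalfPlane.coe_re, UpperHalfPlane.coe_re] at hre
  rw [UpperHalfPlane.coe_im, UpperHalfPlane.coe_im] at him
  set m : ℤ := ⌊z₀.re⌋ with hm
  set n : ℤ := ⌊τ.re + 1 / 2⌋ with hn
  have hm1 : (m : ℝ) ≤ z₀.re := Int.floor_le _
  have hm2 : z₀.re < m + 1 := Int.lt_floor_add_one _
  have hn1 : (n : ℝ) ≤ τ.re + 1 / 2 := Int.floor_le _
  have hn2 : τ.re + 1 / 2 < n + 1 := Int.lt_floor_add_one _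
  have hre' := abs_lt.mp hre
  have him' := abs_lt.mp him
  have hlo : m - 1 ≤ n := by
    have : (m : ℤ) - 1 < n + 1 := by exact_mod_cast (by linarith : (m : ℝ) - 1 < n + 1)
    omega
  have hhi : n ≤ m + 2 := by
    have : n < m + 3 := by exact_mod_cast (by linarith : (n : ℝ) < m + 3)
    omega
  refine ⟨⟨(n - (m - 1)).toNat, by omega⟩, ?_⟩
  have hidx : m - 1 + (((n - (m - 1)).toNat : ℕ) : ℤ) = n := by
    rw [Int.toNat_of_nonneg (by omega)]; ring
  rw [hidx]
  -- `τ = T^n • σ` with `σ = T^(-n) • τ` in the cusp region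
  have hσ : ModularGroup.T ^ (-n) • τ ∈ {σ : ℍ | Y < σ.im} ∩ ModularGroup.fd := by
    refine ⟨?_, ?_, ?_⟩
    · show Y < (ModularGroup.T ^ (-n) • τ).im
      rw [ModularGroup.im_T_zpow_smul]; linarith
    · have h1 : (ModularGroup.T ^ (-n) • τ).im ^ 2 ≤
          Complex.normSq ((ModularGroup.T ^ (-n) • τ : ℍ) : ℂ) := by
        rw [Complex.normSq_apply, UpperHalfPlane.coe_re, UpperHalfPlane.coe_im]
        nlinarith [sq_nonneg (ModularGroup.T ^ (-n) • τ).re]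
      have h2 : 1 ≤ (ModularGroup.T ^ (-n) • τ).im ^ 2 := by
        rw [ModularGroup.im_T_zpow_smul]
        nlinarith
      exact h2.trans h1
    · rw [ModularGroup.re_T_zpow_smul, Int.cast_neg, abs_le]
      constructor <;> linarith
  have heq :
      ((ModularGroup.T ^ n : SL(2, ℤ)) : GL (Fin 2) ℝ) • (ModularGroup.T ^ (-n) • τ) = τ := by
    rw [← ModularGroup.sl_moeb, smul_smul, ← zpow_add, add_neg_cancel, zpow_zero, one_smul]
  rw [← heq]
  exact Set.smul_mem_smul_set hσ

/-- **The cusp tail of an integrable function**: if `F` is integrable on `𝒟`, then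
`∫_{𝒟 ∩ {Im τ > n}} |F| dμ → 0` as `n → ∞` (dominated convergence). [folklore] -/
private theorem tendsto_lintegral_cuspRegion {F : ℍ → ℝ} (hF : IntegrableOn F ModularGroup.fd) :
    Tendsto (fun n : ℕ ↦ ∫⁻ τ in {τ : ℍ | (n : ℝ) < τ.im} ∩ ModularGroup.fd, ‖F τ‖ₑ)
      atTop (𝓝 0) := by
  set μ : Measure ℍ := (volume : Measure ℍ).restrict ModularGroup.fd with hμ
  have hA : ∀ n : ℕ, MeasurableSet {τ : ℍ | (n : ℝ) < τ.im} := fun n ↦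
    measurableSet_lt measurable_const UpperHalfPlane.continuous_im.measurable
  have heq : ∀ n : ℕ, ∫⁻ τ in {τ : ℍ | (n : ℝ) < τ.im} ∩ ModularGroup.fd, ‖F τ‖ₑ =
      ∫⁻ τ, ({τ : ℍ | (n : ℝ) < τ.im}).indicator (fun τ ↦ ‖F τ‖ₑ) τ ∂μ := fun n ↦ by
    rw [lintegral_indicator (hA n), hμ, Measure.restrict_restrict (hA n)]
  simp_rw [heq]
  have h := tendsto_lintegral_of_dominated_convergence' (μ := μ)
    (F := fun n τ ↦ ({τ : ℍ | (n : ℝ) < τ.im}).indicator (fun τ ↦ ‖F τ‖ₑ) τ) (f := fun _ ↦ 0)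
    (fun τ ↦ ‖F τ‖ₑ) (fun n ↦ (hF.aestronglyMeasurable.enorm).indicator (hA n))
    (fun n ↦ Eventually.of_forall fun τ ↦ Set.indicator_le_self _ _ τ) hF.2.ne
    (Eventually.of_forall fun τ ↦ tendsto_atTop_of_eventually_const (i₀ := ⌈τ.im⌉₊)
      fun n hn ↦ by
        rw [Set.indicator_of_notMem]
        simp only [mem_setOf_eq, not_lt]
        exact (Nat.le_ceil τ.im).trans (by exact_mod_cast hn))
  simpa using h

/-- **Core estimate.** Let `g : ℍ → ℂ` be holomorphic and suppose the densities
`|g(δτ)|² (Im δτ)²`, `δ ∈ SL(2, ℤ)`, are dominated by one function `F` integrable on `𝒟`. Then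
`g ∣[2] γ → 0` at `i∞` for every `γ ∈ SL(2, ℤ)`: for `Im z ≥ n + 1`,
`π |(g∣γ)(z)|² ≤ 4 ∫_{𝒟 ∩ {Im > n}} |F| dμ → 0` (square-integrability in the Petersson norm
(14.11) forces vanishing at every cusp). [cite: IwaniecKowalski2004, §14.1 (14.11)] -/
theorem isZeroAtImInfty_slash_of_dominated {g : ℍ → ℂ} (hg : MDifferentiable 𝓘(ℂ) 𝓘(ℂ) g)
    {F : ℍ → ℝ} (hFi : IntegrableOn F ModularGroup.fd)
    (hdom : ∀ δ : SL(2, ℤ), ∀ τ : ℍ, ‖g (δ • τ)‖ ^ 2 * (δ • τ).im ^ 2 ≤ F τ) (γ : SL(2, ℤ)) :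
    IsZeroAtImInfty (g ∣[(2 : ℤ)] γ) := by
  rw [UpperHalfPlane.isZeroAtImInfty_iff]
  intro ε hε
  -- the tail of the Petersson integral beyond height `n` is at most `ε² / 2`
  obtain ⟨n₀, hn₀⟩ := ENNReal.tendsto_atTop_zero.mp (tendsto_lintegral_cuspRegion hFi)
    (ENNReal.ofReal (ε ^ 2 / 2)) (ENNReal.ofReal_pos.mpr (by positivity))
  set n : ℕ := max n₀ 1 with hn
  have hn1 : (1 : ℝ) ≤ n := by exact_mod_cast le_max_right n₀ 1
  have htail : ∫⁻ τ in {τ : ℍ | (n : ℝ) < τ.im} ∩ ModularGroup.fd, ‖F τ‖ₑ ≤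
      ENNReal.ofReal (ε ^ 2 / 2) := hn₀ n (le_max_left _ _)
  refine ⟨n + 1, fun z hz ↦ ?_⟩
  have hh : MDifferentiable 𝓘(ℂ) 𝓘(ℂ) (g ∣[(2 : ℤ)] γ) := hg.slash (2 : ℤ) (γ : GL (Fin 2) ℝ)
  have hz1 : 1 ≤ z.im := by linarith
  -- the four translates of the cusp region covering the unit ball about `z`
  obtain ⟨D, hD⟩ : ∃ D : Set ℍ, D = {σ : ℍ | (n : ℝ) < σ.im} ∩ ModularGroup.fd := ⟨_, rfl⟩
  obtain ⟨c, hc⟩ : ∃ c : Fin 4 → GL (Fin 2) ℝ, c = fun i : Fin 4 ↦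
      ((ModularGroup.T ^ (⌊z.re⌋ - 1 + (i : ℤ)) : SL(2, ℤ)) : GL (Fin 2) ℝ) := ⟨_, rfl⟩
  have hcover : ((↑) : ℍ → ℂ) ⁻¹' Metric.ball (z : ℂ) 1 ⊆ ⋃ i : Fin 4, c i • D := by
    intro τ hτ
    obtain ⟨i, hi⟩ := exists_mem_T_zpow_smul hn1 hz hτ
    rw [hc, hD]
    exact Set.mem_iUnion.mpr ⟨i, hi⟩
  -- each translate contributes at most the tail
  have hterm : ∀ i : Fin 4, ∫⁻ τ in c i • D,
      ENNReal.ofReal (‖g (γ • τ)‖ ^ 2 * (γ • τ).im ^ 2) ≤ ENNReal.ofReal (ε ^ 2 / 2) := by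
    intro i
    rw [lintegral_smul_set_eq, hD]
    refine le_trans (lintegral_mono fun τ ↦ ?_) htail
    have h1 := hdom (γ * ModularGroup.T ^ (⌊z.re⌋ - 1 + (i : ℤ))) τ
    rw [mul_smul] at h1
    have h0 : 0 ≤ F τ := le_trans (by positivity) h1
    rw [Real.enorm_of_nonneg h0, hc]
    exact ENNReal.ofReal_le_ofReal h1
  -- assemble: `π |(g∣γ)(z)|² ≤ 4 · ε²/2`
  have hmain : ENNReal.ofReal (π * ‖(g ∣[(2 : ℤ)] γ) z‖ ^ 2) ≤ ENNReal.ofReal (2 * ε ^ 2) := by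
    calc ENNReal.ofReal (π * ‖(g ∣[(2 : ℤ)] γ) z‖ ^ 2)
        ≤ ∫⁻ w in Metric.ball (z : ℂ) 1, ‖(g ∣[(2 : ℤ)] γ) (ofComplex w)‖ₑ ^ 2 :=
          ofReal_pi_mul_norm_sq_le_lintegral_ball _ hh hz1
      _ = ∫⁻ τ in ((↑) : ℍ → ℂ) ⁻¹' Metric.ball (z : ℂ) 1,
            ENNReal.ofReal (‖(g ∣[(2 : ℤ)] γ) τ‖ ^ 2 * τ.im ^ 2) :=
          lintegral_ball_eq_lintegral_preimage _ hh.continuous hz1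
      _ = ∫⁻ τ in ((↑) : ℍ → ℂ) ⁻¹' Metric.ball (z : ℂ) 1,
            ENNReal.ofReal (‖g (γ • τ)‖ ^ 2 * (γ • τ).im ^ 2) := by
          refine lintegral_congr fun τ ↦ ?_
          rw [norm_sq_slash_mul_im_sq]
      _ ≤ ∫⁻ τ in ⋃ i : Fin 4, c i • D, ENNReal.ofReal (‖g (γ • τ)‖ ^ 2 * (γ • τ).im ^ 2) :=
          lintegral_mono_set hcover
      _ ≤ ∑' i : Fin 4, ∫⁻ τ in c i • D, ENNReal.ofReal (‖g (γ • τ)‖ ^ 2 * (γ • τ).im ^ 2) :=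
          lintegral_iUnion_le _ _
      _ = ∑ i : Fin 4, ∫⁻ τ in c i • D, ENNReal.ofReal (‖g (γ • τ)‖ ^ 2 * (γ • τ).im ^ 2) :=
          tsum_fintype _
      _ ≤ ∑ _i : Fin 4, ENNReal.ofReal (ε ^ 2 / 2) := Finset.sum_le_sum fun i _ ↦ hterm i
      _ = ENNReal.ofReal (2 * ε ^ 2) := by
          rw [Finset.sum_const, Finset.card_univ, Fintype.card_fin, nsmul_eq_mul, Nat.cast_ofNat,
            ← ENNReal.ofReal_ofNat 4, ← ENNReal.ofReal_mul (by norm_num)]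
          congr 1
          ring
  have hreal : π * ‖(g ∣[(2 : ℤ)] γ) z‖ ^ 2 ≤ 2 * ε ^ 2 :=
    (ENNReal.ofReal_le_ofReal_iff (by positivity)).mp hmain
  have hsq : ‖(g ∣[(2 : ℤ)] γ) z‖ ^ 2 ≤ ε ^ 2 := by
    nlinarith [sq_nonneg ‖(g ∣[(2 : ℤ)] γ) z‖, Real.pi_gt_three]
  exact (pow_le_pow_iff_left₀ (norm_nonneg _) hε.le two_ne_zero).mp hsq

/-! ### The theorem -/

/-- **A square-integrable holomorphic function of weight `2` for `Γ₀(N)` is a cusp form** (the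
statement `CuspFormOfL2`, stub T5 of the weight-`2` Poincaré-series skeleton, VERBATIM): if
`g : ℍ → ℂ` is holomorphic, `g(γz) = (cz+d)² g(z)` for all `γ ∈ Γ₀(N)`, and
`PeterssonSqIntegrable N 2 g`, then there is a `CuspForm (Gamma0 N) 2` with underlying function
`g`. Holomorphy and slash-invariance are the hypotheses; every cusp of `Γ₀(N)` is `γ • ∞` with
`γ ∈ SL(2, ℤ)` (Mathlib, arithmetic subgroups), and `g ∣[2] γ → 0` at `i∞` by
`isZeroAtImInfty_slash_of_dominated` with `F` the integrand of `PeterssonSqIntegrable`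
(`exists_coset_term_eq`). [cite: IwaniecKowalski2004, §14.1 (14.11)] -/
theorem cuspFormOfL2 (N : ℕ) [NeZero N] (g : ℍ → ℂ) (hg : MDifferentiable 𝓘(ℂ) 𝓘(ℂ) g)
    (hinv : ∀ γ : SL(2, ℤ), γ ∈ Gamma0 N → ∀ z : ℍ,
      g (γ • z) = (rowDenom ((γ : Matrix (Fin 2) (Fin 2) ℤ) 1) z) ^ 2 * g z)
    (hL2 : PeterssonSqIntegrable N 2 g) :
    ∃ f : CuspForm (Gamma0 N) 2, ∀ z : ℍ, f z = g z := by
  letI := Fintype.ofFinite (𝒮ℒ ⧸ (Gamma0 N : Subgroup (GL (Fin 2) ℝ)).subgroupOf 𝒮ℒ)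
  have hL2' : IntegrableOn
      (fun τ : ℍ ↦ ∑ q : 𝒮ℒ ⧸ (Gamma0 N : Subgroup (GL (Fin 2) ℝ)).subgroupOf 𝒮ℒ,
        ‖g (((q.out : 𝒮ℒ) : GL (Fin 2) ℝ)⁻¹ • τ)‖ ^ 2 *
          ((((q.out : 𝒮ℒ) : GL (Fin 2) ℝ)⁻¹ • τ).im) ^ (2 : ℤ)) ModularGroup.fd := hL2
  have hdom : ∀ δ : SL(2, ℤ), ∀ τ : ℍ, ‖g (δ • τ)‖ ^ 2 * (δ • τ).im ^ 2 ≤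
      ∑ q : 𝒮ℒ ⧸ (Gamma0 N : Subgroup (GL (Fin 2) ℝ)).subgroupOf 𝒮ℒ,
        ‖g (((q.out : 𝒮ℒ) : GL (Fin 2) ℝ)⁻¹ • τ)‖ ^ 2 *
          ((((q.out : 𝒮ℒ) : GL (Fin 2) ℝ)⁻¹ • τ).im) ^ (2 : ℤ) := by
    intro δ τ
    obtain ⟨q, hq⟩ := exists_coset_term_eq hinv δ
    rw [← hq τ]
    simp only [zpow_ofNat]
    exact Finset.single_le_sum
      (f := fun q : 𝒮ℒ ⧸ (Gamma0 N : Subgroup (GL (Fin 2) ℝ)).subgroupOf 𝒮ℒ ↦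
        ‖g (((q.out : 𝒮ℒ) : GL (Fin 2) ℝ)⁻¹ • τ)‖ ^ 2 *
          ((((q.out : 𝒮ℒ) : GL (Fin 2) ℝ)⁻¹ • τ).im) ^ 2)
      (fun q _ ↦ by positivity) (Finset.mem_univ q)
  have hzero : ∀ γ : SL(2, ℤ), IsZeroAtImInfty (g ∣[(2 : ℤ)] γ) := fun γ ↦
    isZeroAtImInfty_slash_of_dominated hg hL2' hdom γ
  refine ⟨{ toFun := g
            slash_action_eq' := fun x hx ↦ ?_
            holo' := hg
            zero_at_cusps' := fun {c} hc ↦ ?_ }, fun z ↦ rfl⟩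
  · obtain ⟨β, hβ, rfl⟩ := Subgroup.mem_map.mp hx
    exact slash_eq_self_of_invariant hinv hβ
  · have hc' : IsCusp c 𝒮ℒ :=
      (Subgroup.IsArithmetic.isCusp_iff_isCusp_SL2Z (Gamma0 N : Subgroup (GL (Fin 2) ℝ))).mp hc
    rw [OnePoint.isZeroAt_iff_forall_SL2Z hc']
    exact fun γ _ ↦ hzero γ

end Literature.NumberTheory.ModularForms.PoincareWeightTwo

end
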